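import Summits.Ventures.Crystal3D.Theorems.StickyWulffConstantCoaxialWallLawPayerEndPairsMulti
import Summits.Ventures.Crystal3D.Theorems.StickyWulffConstantCoaxialWallLawTriadic
import Summits.Ventures.Crystal3D.Theorems.StickyWulffConstantCoaxialWallLawSources
import Summits.Ventures.Crystal3D.Theorems.StickyWulffConstantCoaxialWallLawBandCount
import Summits.Ventures.Crystal3D.Theorems.StickyWulffConstantCoaxialWallLawTwinFrames
import Summits.Ventures.Crystal3D.Theorems.StickyWulffConstantNoReconstructionGainSymmetry
import HarnessLib

/-!
# End accounting, census-free, multi-source IV′: the generic translation cell's POOLED END PAIRS, exported (two-plate form)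

HONEST FRAMING. Part of the venture `Summits/Ventures/Crystal3D` (cell `crystal3d-full`), helper for the crux
`CoaxialWallLaw` (stmt-Ventures-19481) of `route-Ventures-StickyWulffConstant`, REGISTERED line `WallLedgerF`
(planner cf-p1), open stub `stub_coaxialTwoSlabAdhesion` (general fillings).  Rung credit only; F-C1 not moved.
Memo HOME/wall-19481-p2/F-NEXT-SPEC.md §S1 (19481-p2 g4), planner (xxv) two-plate charging.  The text of
`wordNet_trans_payers_ge_generic_multi` (`…PayerTransCellGenericMulti`, B4a) with the family-blind capacity NOT applied
(`word_endPairs_multiExcl_inv`, `…PayerEndPairsMulti`): the full upward bond flux of the bottom plate of a GENERIC-offset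
translation pair is bounded by the number of END PAIRS of a pooled pair set `T`, exported with the pair properties, the
two-payer property and, for every pair, the 3-ADIC INVARIANT of its end ball `b`: `3^k (b − s₁) ∈ G₀ Λ₀` for some `k`.
In the two-plate count the top plate's pairs carry the invariant with `s₂`, so bottom and top pairs are DISJOINT without
any word comparison (a common end ball would put `3^(k+j) (s₂ − s₁)` in `G₀ Λ₀`, against `hgen`):

`√2 · (Σ_{r rising} (G₀ r)₂) · π ρ² − 12·(12√2π + 36R₀ + 55440) ρ ≤ #T`.

WHAT THIS IS NOT: not the two-plate cell; F-C1 not moved.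
-/
noncomputable section

namespace Summit.Ventures.Crystal3D.Theorems

open Summit.Ventures.Crystal3D Finset
open Literature.MathematicalPhysics.StatisticalMechanics (fccStacking)
open scoped InnerProductSpace

open scoped Classical in
/-- **The CENSUS-FREE multi-root count feeds the payers (translation cell, generic shift).**  See the module
docstring. -/
theorem wordNet_trans_endPairs_generic_multi
    {δ : ℝ} (hg : KissingGap δ) (hc : KissingClassification δ)
    (G₀ : EuclideanSpace ℝ (Fin 3) ≃ₗᵢ[ℝ] EuclideanSpace ℝ (Fin 3))
    (s₁ s₂ : EuclideanSpace ℝ (Fin 3)) (X P₁ P₂ : Finset (EuclideanSpace ℝ (Fin 3))) (R₀ h ρ : ℝ)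
    (hR₀ : 10 ≤ R₀) (hh : 0 ≤ h) (hρ : R₀ ≤ ρ)
    (hX : ∀ p ∈ X, ∀ q ∈ X, p ≠ q → 1 ≤ dist p q)
    (hcell : ∀ p ∈ X, -(2 * R₀) ≤ p 2 ∧ p 2 ≤ h + 2 * R₀ ∧ p 0 ^ 2 + p 1 ^ 2 ≤ ρ ^ 2)
    (hP₁X : P₁ ⊆ X) (hP₂X : P₂ ⊆ X)
    (hP₁ : ∀ p, p ∈ P₁ ↔ (p ∈ (fun q => G₀ q + s₁) '' fccStacking 1 (Real.sqrt (2 / 3)) ∧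
      -(2 * R₀) ≤ p 2 ∧ p 2 ≤ -R₀ ∧ p 0 ^ 2 + p 1 ^ 2 ≤ ρ ^ 2))
    (hP₂ : ∀ p, p ∈ P₂ ↔ (p ∈ (fun q => G₀ q + s₂) '' fccStacking 1 (Real.sqrt (2 / 3)) ∧
      h + R₀ ≤ p 2 ∧ p 2 ≤ h + 2 * R₀ ∧ p 0 ^ 2 + p 1 ^ 2 ≤ ρ ^ 2))
    (hgen : ∀ k : ℕ, ∀ q ∈ fccStacking 1 (Real.sqrt (2 / 3)), ((3 : ℝ) ^ k) • (s₂ - s₁) ≠ G₀ q) :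
    ∃ T : Finset (EuclideanSpace ℝ (Fin 3) × EuclideanSpace ℝ (Fin 3)),
      Real.sqrt 2 * (∑ r ∈ fccSlots.filter (fun r => 0 < (G₀ r) 2), (G₀ r) 2) * Real.pi * ρ ^ 2 -
          12 * (12 * Real.sqrt 2 * Real.pi + 36 * R₀ + 55440) * ρ ≤ (T.card : ℝ) ∧
      (∀ bq ∈ T, bq.1 ∈ X ∧ bq.2 ∈ X ∧ dist bq.1 bq.2 = 1 ∧ -R₀ - 1 ≤ bq.1 2 ∧ bq.1 2 < h + R₀ + 1) ∧
      (∀ bq ∈ T, (X.filter fun q => dist bq.1 q = 1).card ≤ 11 ∨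
        ∃ z₁ ∈ X, ∃ z₂ ∈ X, z₁ ≠ z₂ ∧ dist bq.1 z₁ = 1 ∧ dist bq.1 z₂ = 1 ∧
          (X.filter fun q => dist z₁ q = 1).card ≤ 11 ∧ (X.filter fun q => dist z₂ q = 1).card ≤ 11) ∧
      (∀ bq ∈ T, ∃ k : ℕ, ∃ q ∈ fccStacking 1 (Real.sqrt (2 / 3)), ((3 : ℝ) ^ k) • (bq.1 - s₁) = G₀ q) := by
  set RT := fccSlots.filter (fun r => 0 < (G₀ r) 2) with hRTdef
  have hRT : ∀ r ∈ RT, r ∈ fccSlots := fun r hr => (mem_filter.1 hr).1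
  have hRTup : ∀ r ∈ RT, 0 < (G₀ r) 2 := fun r hr => (mem_filter.1 hr).2
  have hRTcard : (RT.card : ℝ) ≤ 12 := by
    have : RT.card ≤ 12 := (card_le_card (filter_subset _ _)).trans (by rw [card_fccSlots])
    exact_mod_cast this
  have hr : 0 < Real.sqrt (2 / 3) := Real.sqrt_pos.2 (by norm_num)
  have hR₀3 : (3 : ℝ) ≤ R₀ := by linarith
  have hρ0 : (0 : ℝ) ≤ ρ := by linarith
  have hρ1 : (1 : ℝ) ≤ ρ := by linarith
  -- the word data over the bottom frame
  set Fw : List (EuclideanSpace ℝ (Fin 3)) → (EuclideanSpace ℝ (Fin 3) ≃ₗᵢ[ℝ] EuclideanSpace ℝ (Fin 3)) :=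
    fun κ => κ.foldr (fun μ G => ((ℝ ∙ μ)ᗮ.reflection).trans G) G₀ with hFw
  set uw : EuclideanSpace ℝ (Fin 3) → List (EuclideanSpace ℝ (Fin 3)) → EuclideanSpace ℝ (Fin 3) :=
    fun r κ => κ.foldr (fun _ v => -v) r with huw
  set WFw : EuclideanSpace ℝ (Fin 3) → List (EuclideanSpace ℝ (Fin 3)) → Prop := fun r κ =>
    List.rec (motive := fun _ => Prop) True (fun μ κ' ih => ih ∧ ‖μ‖ = 1 ∧
      (∀ w ∈ fccSlots, ⟪w, μ⟫_ℝ = 0 ∨ ⟪w, μ⟫_ℝ = Real.sqrt (2 / 3) ∨ ⟪w, μ⟫_ℝ = -Real.sqrt (2 / 3)) ∧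
      ⟪uw r κ', μ⟫_ℝ = Real.sqrt (2 / 3) ∧ ∀ μ' κ'', κ' = μ' :: κ'' → μ' ≠ -μ) κ with hWFw
  set nextw : List (EuclideanSpace ℝ (Fin 3)) → EuclideanSpace ℝ (Fin 3) → List (EuclideanSpace ℝ (Fin 3)) :=
    fun κ m => @ite _ (∃ μ κ', κ = μ :: κ' ∧ (Fw κ).symm m = -μ) (Classical.propDecidable _) κ.tail
      ((Fw κ).symm m :: κ) with hnextw
  have hF0 : Fw [] = G₀ := rfl
  have hFc : ∀ μ κ, Fw (μ :: κ) = ((ℝ ∙ μ)ᗮ.reflection).trans (Fw κ) := fun _ _ => rfl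
  have hu0 : ∀ r, uw r [] = r := fun _ => rfl
  have huc : ∀ r μ κ, uw r (μ :: κ) = -uw r κ := fun _ _ _ => rfl
  have hWF0 : ∀ r, WFw r [] := fun _ => trivial
  have hWFc : ∀ r μ κ, WFw r (μ :: κ) ↔ (WFw r κ ∧ ‖μ‖ = 1 ∧
      (∀ w ∈ fccSlots, ⟪w, μ⟫_ℝ = 0 ∨ ⟪w, μ⟫_ℝ = Real.sqrt (2 / 3) ∨ ⟪w, μ⟫_ℝ = -Real.sqrt (2 / 3)) ∧
      ⟪uw r κ, μ⟫_ℝ = Real.sqrt (2 / 3) ∧ ∀ μ' κ', κ = μ' :: κ' → μ' ≠ -μ) := fun _ _ _ => Iff.rfl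
  have hnext_pop : ∀ μ κ' (m : EuclideanSpace ℝ (Fin 3)), (Fw (μ :: κ')).symm m = -μ → nextw (μ :: κ') m = κ' := by
    intro μ κ' m hν
    simp only [hnextw]
    rw [if_pos ⟨μ, κ', rfl, hν⟩, List.tail_cons]
  have hnext_push : ∀ κ (m : EuclideanSpace ℝ (Fin 3)), (∀ μ κ', κ = μ :: κ' → (Fw κ).symm m ≠ -μ) →
      nextw κ m = (Fw κ).symm m :: κ := by
    intro κ m hnp
    simp only [hnextw]
    rw [if_neg]
    rintro ⟨μ, κ', h, hν⟩
    exact hnp μ κ' h hν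
  clear_value nextw WFw uw Fw
  have hu : ∀ r ∈ RT, ∀ κ, uw r κ ∈ fccSlots := fun r hr => word_u_mem (hRT r hr) (hu0 r) (huc r)
  -- the 3-adic position invariant
  set Pst : EuclideanSpace ℝ (Fin 3) × List (EuclideanSpace ℝ (Fin 3)) → Prop := fun v =>
    ∃ k : ℕ, ∃ q ∈ fccStacking 1 (Real.sqrt (2 / 3)), ((3 : ℝ) ^ k) • (v.1 - s₁) = G₀ q with hPst
  have hpow : ∀ (k : ℕ) {x : EuclideanSpace ℝ (Fin 3)}, x ∈ fccStacking 1 (Real.sqrt (2 / 3)) →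
      ((3 : ℝ) ^ k) • x ∈ fccStacking 1 (Real.sqrt (2 / 3)) := by
    intro k x hx
    have := fcc_zsmul_mem (3 ^ k) hx
    push_cast at this
    exact this
  have hstep : ∀ r ∈ RT, ∀ (b : EuclideanSpace ℝ (Fin 3)) (κ : List (EuclideanSpace ℝ (Fin 3))), WFw r κ →
      Pst (b, κ) → ∀ κ', WFw r κ' → Pst (b + Fw κ' (uw r κ'), κ') := by
    intro r hr b κ _ hP κ' hκ'
    obtain ⟨k, q, hq, hkq⟩ := hP
    obtain ⟨q', hq', hd⟩ := word_dir_triadic hFc (hu r hr) (huc r) (hWFc r) hκ'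
    rw [hF0] at hd
    refine ⟨k + κ'.length, ((3 : ℝ) ^ κ'.length) • q + ((3 : ℝ) ^ k) • q',
      fcc_add_site_mem (hpow _ hq) (hpow _ hq'), ?_⟩
    have e : ((3 : ℝ) ^ (k + κ'.length)) • (b + Fw κ' (uw r κ') - s₁) =
        ((3 : ℝ) ^ κ'.length) • (((3 : ℝ) ^ k) • (b - s₁)) + ((3 : ℝ) ^ k) • (((3 : ℝ) ^ κ'.length) • Fw κ' (uw r κ')) := by
      rw [smul_smul, smul_smul, pow_add]; module
    have hkq' : ((3 : ℝ) ^ k) • (b - s₁) = G₀ q := hkq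
    rw [e, hkq', hd, map_add, LinearIsometryEquiv.map_smul, LinearIsometryEquiv.map_smul]
  have hPfull : ∀ r ∈ RT, ∀ (b : EuclideanSpace ℝ (Fin 3)) (κ : List (EuclideanSpace ℝ (Fin 3))), WFw r κ →
      Pst (b, κ) → Pst (b + Fw κ (uw r κ), κ) := fun r hr b κ hκ hP => hstep r hr b κ hκ hP κ hκ
  have hPcross : ∀ r ∈ RT, ∀ (b : EuclideanSpace ℝ (Fin 3)) (κ : List (EuclideanSpace ℝ (Fin 3)))
      (m : EuclideanSpace ℝ (Fin 3)),
      WFw r κ → WFw r (nextw κ m) → Pst (b, κ) → Pst (b + Fw (nextw κ m) (uw r (nextw κ m)), nextw κ m) :=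
    fun r hr b κ m hκ hκ' hP => hstep r hr b κ hκ hP _ hκ'
  have hPtop : ∀ r ∈ RT, ∀ (b : EuclideanSpace ℝ (Fin 3)) (κ : List (EuclideanSpace ℝ (Fin 3))),
      WFw r κ → Pst (b, κ) → b ∉ P₂ := by
    intro r _ b κ _ hP hb
    obtain ⟨k, q, hq, hkq⟩ := hP
    obtain ⟨⟨q₂, hq₂, hb₂⟩, -, -, -⟩ := (hP₂ b).1 hb
    have hmem : q - ((3 : ℝ) ^ k) • q₂ ∈ fccStacking 1 (Real.sqrt (2 / 3)) := by
      rw [sub_eq_add_neg]; exact fcc_add_site_mem hq (fcc_neg_mem (hpow k hq₂))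
    apply hgen k _ hmem
    have hkq' : ((3 : ℝ) ^ k) • (b - s₁) = G₀ q := hkq
    have e : s₂ - s₁ = (b - s₁) - (b - s₂) := by abel
    have hb' : b - s₂ = G₀ q₂ := by rw [← hb₂]; simp
    rw [e, smul_sub, hkq', hb', map_sub, LinearIsometryEquiv.map_smul]
  -- the inner sample
  set zcut : ℝ := h + R₀ + 1 with hzcut
  set P' : Finset (EuclideanSpace ℝ (Fin 3)) := P₁.filter fun p =>
    -(2 * R₀) + 1 ≤ p 2 ∧ p 2 ≤ -R₀ - 1 ∧ p 0 ^ 2 + p 1 ^ 2 ≤ (ρ - 1) ^ 2 with hP'def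
  have hP'iff : ∀ p, p ∈ P' ↔ (p ∈ (fun q => G₀ q + s₁) '' fccStacking 1 (Real.sqrt (2 / 3)) ∧
      -(2 * R₀) + 1 ≤ p 2 ∧ p 2 ≤ -R₀ - 1 ∧ p 0 ^ 2 + p 1 ^ 2 ≤ (ρ - 1) ^ 2) := by
    intro p
    rw [hP'def, mem_filter, hP₁]
    constructor
    · rintro ⟨⟨hΛ, -, -, -⟩, h1, h2, h3⟩; exact ⟨hΛ, h1, h2, h3⟩
    · rintro ⟨hΛ, h1, h2, h3⟩
      have hρ1' : (0 : ℝ) ≤ ρ - 1 := by linarith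
      exact ⟨⟨hΛ, by linarith, by linarith, by nlinarith⟩, h1, h2, h3⟩
  -- the inner sample has full shells (complete sample)
  have hP'full : ∀ p ∈ P', ∀ w ∈ fccSlots, p + Fw [] w ∈ X := by
    intro p hp w hw
    rw [hF0]
    obtain ⟨hΛ, h1, h2, h3⟩ := (hP'iff p).1 hp
    apply hP₁X
    rw [hP₁]
    have hw2 : |(G₀ w) 2| ≤ 1 := by rw [apply_two_eq_inner_e₃]; exact abs_inner_slot_le_one G₀ hw
    obtain ⟨hw2a, hw2b⟩ := abs_le.1 hw2
    refine ⟨movedFcc_add_site_mem G₀ s₁ hΛ (mem_fcc_of_mem_fccSlots hw), ?_, ?_, ?_⟩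
    · show -(2 * R₀) ≤ (p + G₀ w) 2
      rw [PiLp.add_apply]; linarith
    · show (p + G₀ w) 2 ≤ -R₀
      rw [PiLp.add_apply]; linarith
    · show (p + G₀ w) 0 ^ 2 + (p + G₀ w) 1 ^ 2 ≤ ρ ^ 2
      have hρ1' : (0 : ℝ) ≤ ρ - 1 := by linarith
      have hsl : Real.sqrt (p 0 ^ 2 + p 1 ^ 2) ≤ ρ - 1 := by
        rw [← Real.sqrt_sq hρ1']; exact Real.sqrt_le_sqrt h3
      have e1 := sqrt_lateral_add_le p (G₀ w)
      rw [LinearIsometryEquiv.norm_map, norm_eq_one_of_mem_fccSlots hw] at e1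
      have e3 : Real.sqrt ((p + G₀ w) 0 ^ 2 + (p + G₀ w) 1 ^ 2) ≤ ρ := by linarith
      have e4 := Real.sq_sqrt (by positivity : (0 : ℝ) ≤ (p + G₀ w) 0 ^ 2 + (p + G₀ w) 1 ^ 2)
      have e5 : (0 : ℝ) ≤ Real.sqrt ((p + G₀ w) 0 ^ 2 + (p + G₀ w) 1 ^ 2) := Real.sqrt_nonneg _
      nlinarith
  -- (1) the multi-root NET count of the word automaton
  have hP₁' : ∀ p, p ∈ P₁ ↔ (p ∈ (fun q => Fw [] q + s₁) '' fccStacking 1 (Real.sqrt (2 / 3)) ∧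
      -(2 * R₀) ≤ p 2 ∧ p 2 ≤ -R₀ ∧ p 0 ^ 2 + p 1 ^ 2 ≤ ρ ^ 2) := by rw [hF0]; exact hP₁
  have hP'iff' : ∀ p, p ∈ P' ↔ (p ∈ (fun q => Fw [] q + s₁) '' fccStacking 1 (Real.sqrt (2 / 3)) ∧
      -(2 * R₀) + 1 ≤ p 2 ∧ p 2 ≤ -R₀ - 1 ∧ p 0 ^ 2 + p 1 ^ 2 ≤ (ρ - 1) ^ 2) := by rw [hF0]; exact hP'iff
  have hup : ∀ r ∈ RT, 0 < (Fw [] r) 2 := by intro r hr; rw [hF0]; exact hRTup r hr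
  have hPsrc : ∀ r ∈ RT, ∀ p ∈ P', Pst (p + Fw [] r, []) := by
    intro r hr p hp
    obtain ⟨⟨q₀, hq₀, hp₀⟩, -, -, -⟩ := (hP'iff p).1 hp
    refine ⟨0, q₀ + r, fcc_add_site_mem hq₀ (mem_fcc_of_mem_fccSlots (hRT r hr)), ?_⟩
    show ((3 : ℝ) ^ 0) • (p + Fw [] r - s₁) = G₀ (q₀ + r)
    rw [pow_zero, one_smul, hF0, ← hp₀, map_add]
    simp only
    abel
  obtain ⟨T, hTkey, hTpair, hTpay, hTinv, -⟩ := word_endPairs_multiExcl_inv (F := Fw) (u := uw) (WF := WFw)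
    (next := nextw) (t₁ := s₁) (t₂ := s₂) (P := Pst) hg hc hX hFc RT hRT (fun r _ => hu0 r) (fun r _ => huc r)
    (fun r _ => hWF0 r) (fun r _ => hWFc r) hnext_pop hnext_push G₀ hPfull hPcross
    (fun r hr b κ hκ hP hb _ _ => hPtop r hr b κ hκ hP hb) hup hR₀3 hρ hcell hP₁X hP₂X hP₁' hP'iff' hP'full hPsrc hP₂
  rw [hF0] at hTkey
  -- (2) the sources, per root
  have hsources : ∀ r ∈ RT, Real.sqrt 2 * (G₀ r) 2 * Real.pi * (ρ - 1) ^ 2 -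
        10 * Real.sqrt 2 * Real.pi * (ρ - 1) - 36 * R₀ * ρ ≤
      ((P'.filter fun p => (∀ w ∈ fccSlots, p + G₀ w ∈ X) ∧
          -R₀ - 1 < (p + G₀ r) 2 ∧ (p + G₀ r) 2 < zcut).card : ℝ) := by
    intro r hr
    have key := card_vertical_tops_ge G₀ s₁ X P₁ P' R₀ ρ zcut hR₀3 hρ (by rw [hzcut]; linarith)
      hX hP₁X hP₁ hP'iff (hRT r hr) (by rw [← apply_two_eq_inner_e₃]; exact (hRTup r hr).le)
    rw [← apply_two_eq_inner_e₃, abs_of_pos (hRTup r hr)] at key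
    exact key
  -- (3) the rims
  set RIMT := X.filter fun s => zcut ≤ s 2 ∧ s 2 ≤ zcut + 1 ∧ (ρ - 2) ^ 2 < s 0 ^ 2 + s 1 ^ 2 with hRIMT
  have hrimT : (RIMT.card : ℝ) ≤ 144 * ρ := by
    have hsep : ∀ p ∈ RIMT, ∀ q ∈ RIMT, p ≠ q → 1 ≤ dist p q :=
      fun p hp q hq hpq => hX p (mem_filter.1 hp).1 q (mem_filter.1 hq).1 hpq
    have hmem : ∀ p ∈ RIMT, zcut ≤ p 2 ∧ p 2 ≤ zcut + 1 ∧ (ρ - 2) ^ 2 < p 0 ^ 2 + p 1 ^ 2 ∧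
        p 0 ^ 2 + p 1 ^ 2 ≤ ρ ^ 2 := by
      intro p hp
      obtain ⟨hpX, h1, h2, h3⟩ := mem_filter.1 hp
      exact ⟨h1, h2, h3, (hcell p hpX).2.2⟩
    have key := card_mul_le_of_separated_in_shell RIMT hsep zcut (zcut + 1) (ρ - 2) ρ (by linarith)
      (by linarith) (by linarith) hmem
    have e : (zcut + 1 - zcut + 2) * (Real.pi * (ρ + 1) ^ 2 - Real.pi * (ρ - 2 - 1) ^ 2) =
        (Real.pi / 6) * (144 * ρ - 144) := by ring
    rw [e] at key
    have hπ : 0 < Real.pi / 6 := by positivity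
    have := le_of_mul_le_mul_right (by linarith [key] : (RIMT.card : ℝ) * (Real.pi / 6) ≤
      (144 * ρ - 144) * (Real.pi / 6)) hπ
    linarith
  set RIMB := X.filter fun s => -R₀ - 1 - 1 ≤ s 2 ∧ s 2 < -R₀ - 1 ∧ (ρ - 1) ^ 2 < s 0 ^ 2 + s 1 ^ 2 with hRIMB
  have hrimB : (RIMB.card : ℝ) ≤ 108 * ρ := by
    have hsep : ∀ p ∈ RIMB, ∀ q ∈ RIMB, p ≠ q → 1 ≤ dist p q :=
      fun p hp q hq hpq => hX p (mem_filter.1 hp).1 q (mem_filter.1 hq).1 hpq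
    have hmem : ∀ p ∈ RIMB, -R₀ - 1 - 1 ≤ p 2 ∧ p 2 ≤ -R₀ - 1 ∧ (ρ - 1) ^ 2 < p 0 ^ 2 + p 1 ^ 2 ∧
        p 0 ^ 2 + p 1 ^ 2 ≤ ρ ^ 2 := by
      intro p hp
      obtain ⟨hpX, h1, h2, h3⟩ := mem_filter.1 hp
      exact ⟨h1, h2.le, h3, (hcell p hpX).2.2⟩
    have key := card_mul_le_of_separated_in_shell RIMB hsep (-R₀ - 1 - 1) (-R₀ - 1) (ρ - 1) ρ (by linarith)
      (by linarith) (by linarith) hmem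
    have e : (-R₀ - 1 - (-R₀ - 1 - 1) + 2) * (Real.pi * (ρ + 1) ^ 2 - Real.pi * (ρ - 1 - 1) ^ 2) =
        (Real.pi / 6) * (108 * ρ - 54) := by ring
    rw [e] at key
    have hπ : 0 < Real.pi / 6 := by positivity
    have := le_of_mul_le_mul_right (by linarith [key] : (RIMB.card : ℝ) * (Real.pi / 6) ≤
      (108 * ρ - 54) * (Real.pi / 6)) hπ
    linarith
  -- (4) arithmetic
  have hcast : ((∑ r ∈ RT, (P'.filter fun p => (∀ w ∈ fccSlots, p + G₀ w ∈ X) ∧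
      -R₀ - 1 < (p + G₀ r) 2 ∧ (p + G₀ r) 2 < zcut).card : ℕ) : ℝ) ≤
      (T.card : ℝ) + (RT.card : ℝ) * (220 * (RIMT.card : ℝ) + 220 * (RIMB.card : ℝ)) := by
    have h0 : ∑ r ∈ RT, (P'.filter fun p => (∀ w ∈ fccSlots, p + G₀ w ∈ X) ∧
        -R₀ - 1 < (p + G₀ r) 2 ∧ (p + G₀ r) 2 < zcut).card ≤
        T.card + RT.card * (220 * RIMT.card + 220 * RIMB.card) := hTkey
    exact_mod_cast h0
  rw [Nat.cast_sum] at hcast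
  -- per root: the source bound in the form `√2 α π ρ² − (12√2π + 36R₀) ρ ≤ #sources_r`
  have h2 : 0 ≤ Real.sqrt 2 := Real.sqrt_nonneg _
  have hπ : 0 ≤ Real.pi := Real.pi_pos.le
  have h2π : 0 ≤ Real.sqrt 2 * Real.pi * ρ := mul_nonneg (mul_nonneg h2 hπ) hρ0
  have hper : ∀ r ∈ RT, Real.sqrt 2 * (G₀ r) 2 * Real.pi * ρ ^ 2 - (12 * Real.sqrt 2 * Real.pi + 36 * R₀) * ρ ≤
      ((P'.filter fun p => (∀ w ∈ fccSlots, p + G₀ w ∈ X) ∧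
          -R₀ - 1 < (p + G₀ r) 2 ∧ (p + G₀ r) 2 < zcut).card : ℝ) := by
    intro r hr
    have hs := hsources r hr
    set α := (G₀ r) 2 with hα
    have hα0 : 0 ≤ α := (hRTup r hr).le
    have hαle : α ≤ 1 := by
      have := abs_inner_slot_le_one G₀ (hRT r hr)
      rw [← apply_two_eq_inner_e₃] at this
      exact (abs_le.1 this).2
    have hsq : Real.sqrt 2 * α * Real.pi * (ρ - 1) ^ 2 ≥ Real.sqrt 2 * α * Real.pi * ρ ^ 2 - 2 * Real.sqrt 2 * Real.pi * ρ := by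
      have e : Real.sqrt 2 * α * Real.pi * (ρ - 1) ^ 2 = Real.sqrt 2 * α * Real.pi * ρ ^ 2 -
          2 * Real.sqrt 2 * α * Real.pi * ρ + Real.sqrt 2 * α * Real.pi := by ring
      rw [e]
      have h1 : Real.sqrt 2 * α * Real.pi * ρ ≤ Real.sqrt 2 * Real.pi * ρ := by
        have := mul_le_mul_of_nonneg_left hαle h2π
        have e1 : Real.sqrt 2 * α * Real.pi * ρ = Real.sqrt 2 * Real.pi * ρ * α := by ring
        rw [mul_one] at this; rw [e1]; exact this
      have h3 : 0 ≤ Real.sqrt 2 * α * Real.pi := mul_nonneg (mul_nonneg h2 hα0) hπ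
      linarith
    have h10 : 10 * Real.sqrt 2 * Real.pi * (ρ - 1) ≤ 10 * Real.sqrt 2 * Real.pi * ρ := by nlinarith only [h2π, h2, hπ]
    linarith only [hs, hsq, h10, h2π]
  have hsum := sum_le_sum hper
  rw [sum_sub_distrib, sum_const, nsmul_eq_mul, ← sum_mul, ← sum_mul, ← mul_sum] at hsum
  -- collect: the rims and the per-root losses are at most `12 · (12√2π + 36R₀ + 55440) ρ`
  have hK0 : 0 ≤ (12 * Real.sqrt 2 * Real.pi + 36 * R₀ + 55440) * ρ := by
    have : 0 ≤ 12 * Real.sqrt 2 * Real.pi + 36 * R₀ + 55440 := by positivity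
    exact mul_nonneg this hρ0
  have hloss : (RT.card : ℝ) * ((12 * Real.sqrt 2 * Real.pi + 36 * R₀) * ρ) +
      (RT.card : ℝ) * (220 * (RIMT.card : ℝ) + 220 * (RIMB.card : ℝ)) ≤
      12 * (12 * Real.sqrt 2 * Real.pi + 36 * R₀ + 55440) * ρ := by
    have hrims : 220 * (RIMT.card : ℝ) + 220 * (RIMB.card : ℝ) ≤ 55440 * ρ := by linarith [hrimT, hrimB]
    have hc0 : (0 : ℝ) ≤ RT.card := Nat.cast_nonneg _
    have h1 : (RT.card : ℝ) * ((12 * Real.sqrt 2 * Real.pi + 36 * R₀) * ρ) +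
        (RT.card : ℝ) * (220 * (RIMT.card : ℝ) + 220 * (RIMB.card : ℝ)) ≤
        (RT.card : ℝ) * ((12 * Real.sqrt 2 * Real.pi + 36 * R₀ + 55440) * ρ) := by
      have := mul_le_mul_of_nonneg_left hrims hc0
      nlinarith only [this]
    have h2 := mul_le_mul_of_nonneg_right hRTcard hK0
    linarith only [h1, h2]
  refine ⟨T, by linarith only [hcast, hsum, hloss], hTpair, hTpay, ?_⟩
  intro bq hbq
  obtain ⟨r, -, κ, -, hP⟩ := hTinv bq hbq
  exact hP

end Summit.Ventures.Crystal3D.Theorems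

end
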